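import Summits.BirchSwinnertonDyer.Rank1Residual.X11b.LocalTrivialityBridge
import Literature.NumberTheory.GaloisRepresentations.UnramifiedKummer
import Literature.NumberTheory.GaloisRepresentations.AbsGaloisOuterConj
import Literature.NumberTheory.GaloisRepresentations.BlochKatoSelmerGroup
import HarnessLib

/-!
# X11b, route R1 — the unramified local condition `H¹_ur(F, W)` as "vanishing on the inertia
# group": `range (Γ_{F^nr} → Γ_F) = I_F` and `[φ] ∈ H¹_ur ⟺ φ` principal on `I_F`

HONEST FRAMING (cell `b2b-bsdres`, run/shared/lean/b2b/bsd-rank1-residual/, verbatim in every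
file): the goal of the cell is to DELETE the COMBINATION-SHAPED residual classes of the
Birch–Swinnerton-Dyer formula for ALL analytic-rank `≤ 1` elliptic curves over `ℚ` — "full BSD
formula for every rank `≤ 1` curve in class `C`" assembled STRICTLY from published theorems — so
that the rank-`≤ 1` remainder becomes exactly the CONSTRUCTION-SHAPED classes, which are TYPED
(missing-input `Prop`s), NOT attempted. This is not "finishing BSD". Sub-cell
`b2b-bsdres-multr1-p1` (X11b, route R1 = Castella 2018 Thm. A re-proved along the author's
erratum); a RESEARCH ROUTE; no claim beyond the stated class; X11b stays CONSTRUCTION-SHAPED;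
nothing here changes a label; no named fact is minted (theorems only; no `sorry`).

## Why

The Poitou–Tate fact of the tree (`poitouTate_selmerStructure_duality`, Howard 2004 Thm. 2.1.11)
applies to Selmer structures that are the UNRAMIFIED condition
`unramifiedSubgroup ρ_v 1 = ker (H¹(K_v, M) → H¹(K_v^{nr}, M))` (`BlochKatoSelmerGroup`,
restriction along `absGaloisRestrict K_v K_v^{nr}`, `K_v^{nr} = IsNonarchimedeanLocalField.maxUnramified`)
at almost all places (`SelmerStructure.IsUnramifiedOutside`).  To verify this for the PROPAGATED
Castella structure `acLevelStructure` (step (d) of REPORT §24: at good `v ∤ p`,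
`ker (H¹(K_v, E[p^k]) → H¹(K_v, E[p^∞])) = H¹_ur`) one needs `H¹_ur` in workable form.  For a
non-archimedean local field `F` this file proves

* `range (absGaloisRestrict F F^{nr}) = absInertia F` — the image of `Γ_{F^{nr}} → Γ_F` IS the
  inertia group (`range_absGaloisRestrict_maxUnramified`): `⊇` because `I_F` fixes `F^{nr}`
  pointwise (`mem_absInertia_iff_forall_mem_maxUnramified`) and the chosen copy `e(F^{nr}) ⊆ F̄`
  (`absEmbedding`) lies in `F^{nr}` (`absEmbedding_mem_maxUnramified`: generators go to roots of
  unity of the same order); `⊆` because `e(F^{nr})` contains every root of unity of order prime to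
  `p` (`exists_absEmbedding_eq_of_pow_eq_one`: an injective self-map of the finite set `μ_N(F̄)`
  is onto) and `I_F` is the fixator of those (`mem_absInertia_iff_smul_rootsOfUnity`);
* hence, by `LocBridge.map_oneCocycleClass_eq_zero_iff` (the kernel of a pull-back depends only on
  the range): **`mem_unramifiedSubgroup_one_iff_exists`** — `[φ] ∈ H¹_ur(F, W)` iff `φ` is
  principal on `I_F` (`∃ w, ∀ τ ∈ I_F, φ τ = τ w − w`), for EVERY discrete Galois module `W`
  over `F`; and **`mem_unramifiedSubgroup_one_iff_forall_eq_zero`** — if `I_F` acts trivially on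
  `W`, `[φ] ∈ H¹_ur(F, W)` iff `φ` vanishes on `I_F`.

References: Serre, *Local Fields*, IV §4 Cor. 2 to Prop. 16 (`K_nr = K(μ_{p'})`); Serre,
*Galois Cohomology*, I.§2.4, I.§5.1; Milne, *ADT*, I §2 (unramified cohomology `H¹(G/I, M^I)`);
[Howard2004HeegnerKolyvagin] Def. 2.1.1 (`H¹_f = H¹_ur`), Def. 2.1.10.
-/

noncomputable section

open scoped Classical

open CategoryTheory Field ValuativeRel
open Literature.NumberTheory.GaloisRepresentations
open Literature.NumberTheory.GaloisRepresentations.IsNonarchimedeanLocalField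

universe u

namespace Summit.BirchSwinnertonDyer.Rank1Residual.X11b.LocBridge

section LocalField

variable (F : Type u) [Field F] [ValuativeRel F] [TopologicalSpace F] [IsNonarchimedeanLocalField F]

/-! ## §1. The chosen copy `e(F^{nr})` of `F^{nr}` inside `F̄` is `F^{nr}` -/

omit [TopologicalSpace F] [IsNonarchimedeanLocalField F] in
/-- **`e(F^{nr}) ⊆ F^{nr}`**: the chosen `F`-embedding `e : F^{nr} → F̄` (`absEmbedding`, along
which `absGaloisRestrict F F^{nr}` restricts) takes values in `F^{nr} = F(μ_{p'})` — a generator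
`ζ` (a root of unity of order `N` prime to `p`) goes to a root of unity of the same order, and
`F(μ_{p'})` is generated by those (induction over `IntermediateField.adjoin`).
Serre, *Local Fields*, IV §4 Cor. 2 to Prop. 16. [cite: SerreLocalFields1979, Ch. IV §4 Cor. 2 to Prop. 16] -/
theorem absEmbedding_mem_maxUnramified (x : maxUnramified F) :
    (absEmbedding F (maxUnramified F) x : AlgebraicClosure F) ∈ maxUnramified F := by
  obtain ⟨y, hy⟩ := x
  induction hy using IntermediateField.adjoin_induction with
  | mem y hy =>
    obtain ⟨N, hN, hyN⟩ := hy
    refine IntermediateField.subset_adjoin F _ ⟨N, hN, ?_⟩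
    rw [← map_pow]
    have h1 : (⟨y, IntermediateField.subset_adjoin F _ ⟨N, hN, hyN⟩⟩ : maxUnramified F) ^ N = 1 :=
      Subtype.ext (by rw [SubmonoidClass.coe_pow]; exact hyN)
    rw [h1, map_one]
  | algebraMap a =>
    have h : (⟨algebraMap F (AlgebraicClosure F) a, IntermediateField.algebraMap_mem _ a⟩ :
        maxUnramified F) = algebraMap F (maxUnramified F) a := rfl
    rw [h, AlgHom.commutes]
    exact IntermediateField.algebraMap_mem _ a
  | add y z hy hz ihy ihz =>
    have h : (⟨y + z, add_mem hy hz⟩ : maxUnramified F) = ⟨y, hy⟩ + ⟨z, hz⟩ := rfl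
    rw [h, map_add]
    exact add_mem ihy ihz
  | inv y hy ihy =>
    have h : (⟨y⁻¹, inv_mem hy⟩ : maxUnramified F) = ⟨y, hy⟩⁻¹ := rfl
    rw [h, map_inv₀]
    exact inv_mem ihy
  | mul y z hy hz ihy ihz =>
    have h : (⟨y * z, mul_mem hy hz⟩ : maxUnramified F) = ⟨y, hy⟩ * ⟨z, hz⟩ := rfl
    rw [h, map_mul]
    exact mul_mem ihy ihz

omit [ValuativeRel F] [TopologicalSpace F] [IsNonarchimedeanLocalField F] in
/-- The `N`-th roots of unity of `F̄` form a finite set (`N ≠ 0`). [folklore] -/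
theorem finite_setOf_pow_eq_one {N : ℕ} (hN : N ≠ 0) :
    Set.Finite {ζ : AlgebraicClosure F | ζ ^ N = 1} := by
  refine (Multiset.finite_toSet (Polynomial.nthRoots N (1 : AlgebraicClosure F))).subset ?_
  intro ζ hζ
  exact (Polynomial.mem_nthRoots (Nat.pos_of_ne_zero hN)).mpr hζ

omit [TopologicalSpace F] [IsNonarchimedeanLocalField F] in
/-- **`e(F^{nr}) ⊇ μ_{p'}(F̄)`**: every root of unity `ζ ∈ F̄` of order prime to `p` is `e x` for
some `x ∈ F^{nr}` — `F^{nr}` contains the finite set `μ_N(F̄)`, and `x ↦ e x` is an injective map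
of it into itself, hence onto. [cite: SerreLocalFields1979, Ch. IV §4 Cor. 2 to Prop. 16] -/
theorem exists_absEmbedding_eq_of_pow_eq_one {N : ℕ} (hN : IsUnit ((N : ℕ) : 𝒪[F]))
    {ζ : AlgebraicClosure F} (hζ : ζ ^ N = 1) :
    ∃ x : maxUnramified F, (absEmbedding F (maxUnramified F) x : AlgebraicClosure F) = ζ := by
  have hN0 : N ≠ 0 := by rintro rfl; simp at hN
  -- the finite set `R = μ_N(F̄)` and the self-map `g : R → R`, `ζ ↦ e ⟨ζ, _⟩`
  set R : Set (AlgebraicClosure F) := {ζ : AlgebraicClosure F | ζ ^ N = 1} with hR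
  haveI : Finite R := (finite_setOf_pow_eq_one F hN0).to_subtype
  have hmemM : ∀ ξ : R, (ξ : AlgebraicClosure F) ∈ maxUnramified F := fun ξ ↦
    IntermediateField.subset_adjoin F _ ⟨N, hN, ξ.2⟩
  have hpow : ∀ ξ : R, (absEmbedding F (maxUnramified F) ⟨ξ, hmemM ξ⟩ : AlgebraicClosure F) ^ N = 1 :=
    fun ξ ↦ by
      rw [← map_pow]
      have h1 : (⟨(ξ : AlgebraicClosure F), hmemM ξ⟩ : maxUnramified F) ^ N = 1 :=
        Subtype.ext (by rw [SubmonoidClass.coe_pow]; exact ξ.2)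
      rw [h1, map_one]
  let g : R → R := fun ξ ↦ ⟨absEmbedding F (maxUnramified F) ⟨ξ, hmemM ξ⟩, hpow ξ⟩
  have hg : Function.Injective g := fun ξ ξ' h ↦ by
    have h1 := congrArg (fun r : R ↦ (r : AlgebraicClosure F)) h
    have h2 := (absEmbedding F (maxUnramified F)).injective h1
    exact Subtype.ext (congrArg (fun m : maxUnramified F ↦ (m : AlgebraicClosure F)) h2)
  obtain ⟨ξ, hξ⟩ := (Finite.injective_iff_surjective.mp hg) ⟨ζ, hζ⟩
  exact ⟨⟨ξ, hmemM ξ⟩, congrArg (fun r : R ↦ (r : AlgebraicClosure F)) hξ⟩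

/-! ## §2. `range (Γ_{F^{nr}} → Γ_F) = I_F` -/

/-- **The image of `Γ_{F^{nr}} → Γ_F` is the inertia group `I_F = absInertia F`.**  (`⊆`: an
element of the image fixes `e(F^{nr}) ⊇ μ_{p'}(F̄)`, and `I_F` is the fixator of `μ_{p'}`,
`mem_absInertia_iff_smul_rootsOfUnity`; `⊇`: `I_F` fixes `F^{nr} ⊇ e(F^{nr})` pointwise,
`mem_absInertia_iff_forall_mem_maxUnramified`, and the image is the fixator of `e(F^{nr})`,
`mem_range_absGaloisRestrict_iff_smul_absEmbedding`.)  Serre, *Local Fields*, IV §4 Cor. 2 to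
Prop. 16 ("`K_nr` … obtained by adjoining all roots of unity of order prime to `p`"); Serre,
Invent. Math. 15 (1972) §1.2 (`I = Gal(K_s/K_nr)`).
[cite: SerreLocalFields1979, Ch. IV §4 Cor. 2 to Prop. 16] [cite: SerreInventiones1972, §1.2] -/
theorem range_absGaloisRestrict_maxUnramified :
    (absGaloisRestrict F (maxUnramified F)).range = absInertia F := by
  ext g
  rw [mem_range_absGaloisRestrict_iff_smul_absEmbedding]
  constructor
  · intro hg
    refine mem_absInertia_iff_smul_rootsOfUnity.mpr fun N hN ζ hζ ↦ ?_
    obtain ⟨x, rfl⟩ := exists_absEmbedding_eq_of_pow_eq_one F hN hζ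
    exact hg x
  · intro hg x
    exact mem_absInertia_iff_forall_mem_maxUnramified.mp hg _ (absEmbedding_mem_maxUnramified F x)

/-- Set form of `range_absGaloisRestrict_maxUnramified`. [cite: SerreLocalFields1979, Ch. IV §4 Cor. 2 to Prop. 16] -/
theorem setRange_absGaloisRestrict_maxUnramified :
    Set.range (absGaloisRestrict F (maxUnramified F)) = (absInertia F : Set (absoluteGaloisGroup F)) := by
  rw [← range_absGaloisRestrict_maxUnramified F]
  rfl

/-! ## §3. `H¹_ur(F, W)` = classes principal on (resp. vanishing on) the inertia group -/

variable {F}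
variable {W : Type u} [AddCommGroup W] [TopologicalSpace W] [DiscreteTopology W]
  (ρ : DiscreteGaloisModule F W)

/-- **`[φ] ∈ H¹_ur(F, W) ⟺ φ` is principal on the inertia group**: for every discrete Galois
module `W` over the local field `F` and every continuous crossed homomorphism `φ`,
`[φ] ∈ unramifiedSubgroup ρ 1 = ker (H¹(F, W) → H¹(F^{nr}, W))` iff
`∃ w, ∀ τ ∈ I_F, φ τ = τ w − w` (the restriction is a pull-back along `Γ_{F^{nr}} → Γ_F`, whose
kernel depends only on its range `I_F`; `LocBridge.map_oneCocycleClass_eq_zero_iff`).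
Milne, *ADT*, I §2 (`H¹_ur = H¹(G/I, M^I) = ker (H¹(G, M) → H¹(I, M))`).
[cite: MilneADT2006, Ch. I §2 (unramified cohomology)] -/
theorem mem_unramifiedSubgroup_one_iff_exists (φ : contOneCocycles ρ.toTopRep) :
    oneCocycleClass ρ.toTopRep φ ∈ DiscreteGaloisModule.unramifiedSubgroup ρ 1 ↔
      ∃ w : W, ∀ τ ∈ absInertia F, φ.1 τ = ρ τ w - w := by
  refine (DiscreteGaloisModule.mem_unramifiedSubgroup_iff ρ 1 _).trans ?_
  refine (map_oneCocycleClass_eq_zero_iff ρ.toTopRep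
    (DiscreteGaloisModule.toTopRep (GaloisRep.restrictField (maxUnramified F) ρ))
    (absGaloisRestrict F (maxUnramified F)) (TopRep.ofHom ⟨ContinuousLinearMap.id ℤ W, fun _ ↦ rfl⟩)
    Function.bijective_id φ).trans ?_
  constructor
  · rintro ⟨w, hw⟩
    refine ⟨w, fun τ hτ ↦ ?_⟩
    obtain ⟨l, rfl⟩ : τ ∈ Set.range (absGaloisRestrict F (maxUnramified F)) := by
      rw [setRange_absGaloisRestrict_maxUnramified F]; exact hτ
    exact hw l
  · rintro ⟨w, hw⟩
    refine ⟨w, fun l ↦ hw _ ?_⟩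
    rw [← SetLike.mem_coe, ← setRange_absGaloisRestrict_maxUnramified F]
    exact Set.mem_range_self l

/-- **If the inertia group acts trivially on `W`, `[φ] ∈ H¹_ur(F, W) ⟺ φ` vanishes on `I_F`.**
(Then `H¹_ur(F, W) = H¹(Γ_F/I_F, W)` inflated.) Milne, *ADT*, I §2.
[cite: MilneADT2006, Ch. I §2 (unramified cohomology)] -/
theorem mem_unramifiedSubgroup_one_iff_forall_eq_zero
    (hI : ∀ τ ∈ absInertia F, ∀ w : W, ρ τ w = w) (φ : contOneCocycles ρ.toTopRep) :
    oneCocycleClass ρ.toTopRep φ ∈ DiscreteGaloisModule.unramifiedSubgroup ρ 1 ↔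
      ∀ τ ∈ absInertia F, φ.1 τ = 0 := by
  rw [mem_unramifiedSubgroup_one_iff_exists]
  constructor
  · rintro ⟨w, hw⟩ τ hτ
    rw [hw τ hτ, hI τ hτ, sub_self]
  · intro h
    exact ⟨0, fun τ hτ ↦ by rw [h τ hτ, map_zero, sub_zero]⟩

end LocalField

end Summit.BirchSwinnertonDyer.Rank1Residual.X11b.LocBridge

end
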